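import Mathlib
import Summits.Ventures.DiscreteObjects.Mahler.NonreciprocalMeasureBound
import Literature.NumberTheory.MahlerMeasure.OddCoefficientsBound

/-!
# Nonreciprocal polynomials with odd coefficients have `M ≥ (1+√5)/2` (venture `DiscreteObjects`, target L)

Cell `pub-namedobj`, seat `pub-namedobj-mahler` (gen 8). Framing: lottery ticket; floor = certified
bounds/negative ranges.

**Theorem** (Borwein–Dobrowolski–Mossinghoff 2007, nonreciprocal case; [McKee–Smyth, *Around the Unit
Circle*, Prop. 11.3, second part]).  If `P ∈ ℤ[X]` has all coefficients odd and `P.reverse ≠ ± P`, then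
`M(P) ≥ (1 + √5)/2 = M(z² - z - 1)` (`intMahlerMeasure_ge_goldenRatio_of_odd_nonreciprocal`; no
irreducibility or cyclotomic-freeness is needed).  Proof: in the first step of Smyth's argument,
`ε P = P* (1 + a X^k) + X^{k+1} R` (`BlaschkeData.exists_first_nonpalindromic_coeff`), comparing the
coefficients of `X^k` gives `a = ε P_k - P*_k`, which is EVEN when all coefficients of `P` are odd; so
`|a| ≥ 2`, and gen 7's key inequality `|a|/M ≤ 2(1 - 1/M²)` (`abs_mul_inv_measure_le`) gives
`M² ≥ M + 1`.  Corollary: the Literature named fact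
`Literature.NumberTheory.MahlerMeasure.OddCoefficientsNonreciprocalMahlerBound` holds
(`oddCoefficientsNonreciprocalMahlerBound_holds`).
-/

namespace Summit.Ventures.DiscreteObjects.Mahler

open Polynomial

/-- In `ε P = P* (1 + a X^k) + X^{k+1} R` with `P` monic, the coefficient `a` is
`ε P_k - (P*)_k`. -/
theorem first_coeff_eq {P : ℤ[X]} (hmonic : P.Monic) {ε : ℤ} {k : ℕ} {a : ℤ} {R : ℤ[X]}
    (hid : C ε * P = P.reverse * (1 + C a * X ^ k) + X ^ (k + 1) * R) :
    a = ε * P.coeff k - P.reverse.coeff k := by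
  have h := congrArg (fun Q : ℤ[X] => Q.coeff k) hid
  simp only [coeff_C_mul, mul_add, mul_one, coeff_add] at h
  have h1 : (P.reverse * (C a * X ^ k)).coeff k = a := by
    rw [← mul_assoc, coeff_mul_X_pow', if_pos le_rfl, Nat.sub_self, coeff_mul_C, coeff_zero_reverse,
      hmonic.leadingCoeff, one_mul]
  have h2 : (X ^ (k + 1) * R : ℤ[X]).coeff k = 0 := by
    rw [coeff_X_pow_mul', if_neg (by omega)]
  rw [h1, h2, add_zero] at h
  linarith

/-- If all coefficients of a monic `P` are odd and `ε P = P* (1 + a X^k) + X^{k+1} R` with `a ≠ 0`,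
`ε = ±1`, then `a` is even, hence `|a| ≥ 2`. -/
theorem two_le_abs_first_coeff {P : ℤ[X]} (hmonic : P.Monic) (hodd : ∀ i ≤ P.natDegree, Odd (P.coeff i))
    {ε : ℤ} (hε1 : ε * ε = 1) {k : ℕ} {a : ℤ} {R : ℤ[X]} (ha : a ≠ 0)
    (hid : C ε * P = P.reverse * (1 + C a * X ^ k) + X ^ (k + 1) * R) : 2 ≤ |a| := by
  have hak := first_coeff_eq hmonic hid
  have hε : ε = 1 ∨ ε = -1 := by
    have : |ε| = 1 := by
      have h := congrArg abs hε1
      rw [abs_mul, abs_one] at h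
      nlinarith [abs_nonneg ε]
    rcases abs_eq (zero_le_one' ℤ) |>.mp this with h | h
    · exact Or.inl h
    · exact Or.inr h
  by_cases hkd : k ≤ P.natDegree
  · -- both `P_k` and `P*_k = P_{d-k}` are odd, so `a` is even
    have hPk : Odd (P.coeff k) := hodd k hkd
    have hPrk : Odd (P.reverse.coeff k) := by
      rw [coeff_reverse, revAt_le hkd]
      exact hodd _ (Nat.sub_le _ _)
    have haeven : Even a := by
      rw [hak]
      rcases hε with h | h
      · rw [h, one_mul]; exact Odd.sub_odd hPk hPrk
      · rw [h, neg_one_mul]; exact Odd.sub_odd hPk.neg hPrk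
    obtain ⟨m, hm⟩ := haeven
    have hm0 : m ≠ 0 := by rintro rfl; simp at hm; exact ha hm
    rw [hm, ← two_mul, abs_mul, abs_two]
    have := Int.one_le_abs hm0
    omega
  · -- `k > deg P`: then `a = 0`, contradiction
    exfalso
    push Not at hkd
    have h1 : P.coeff k = 0 := coeff_eq_zero_of_natDegree_lt hkd
    have h2 : P.reverse.coeff k = 0 := by
      apply coeff_eq_zero_of_natDegree_lt
      exact lt_of_le_of_lt (reverse_natDegree_le P) hkd
    rw [h1, h2, mul_zero, sub_zero] at hak
    exact ha hak

/-- From `M⁻¹ + M⁻² ≤ 1` (`M > 0`): `M ≥ (1+√5)/2`. -/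
theorem goldenRatio_le_of_inv {M : ℝ} (hM : 0 < M) (h : M⁻¹ + (M⁻¹) ^ 2 ≤ 1) :
    (1 + Real.sqrt 5) / 2 ≤ M := by
  have hs : Real.sqrt 5 ^ 2 = 5 := Real.sq_sqrt (by norm_num)
  have hs0 : 0 ≤ Real.sqrt 5 := Real.sqrt_nonneg 5
  have hM2 : M + 1 ≤ M ^ 2 := by
    have := mul_le_mul_of_nonneg_right h (le_of_lt (pow_pos hM 2))
    have e : (M⁻¹ + (M⁻¹) ^ 2) * M ^ 2 = M + 1 := by field_simp
    nlinarith [this, e]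
  -- `M² - M - 1 = (M - φ)(M - ψ)`, `ψ = (1-√5)/2 < 0 < M`
  by_contra hlt
  push Not at hlt
  have hψ : 0 < M - (1 - Real.sqrt 5) / 2 := by nlinarith
  have hφ : M - (1 + Real.sqrt 5) / 2 < 0 := by linarith
  have hprod : (M - (1 + Real.sqrt 5) / 2) * (M - (1 - Real.sqrt 5) / 2) < 0 := mul_neg_of_neg_of_pos hφ hψ
  have e : (M - (1 + Real.sqrt 5) / 2) * (M - (1 - Real.sqrt 5) / 2) = M ^ 2 - M - 1 := by
    nlinarith [hs]
  nlinarith [e, hprod, hM2]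

/-- **Nonreciprocal integer polynomials with all coefficients odd have `M ≥ (1+√5)/2`**
([McKee–Smyth, Prop. 11.3, second part]; Borwein–Dobrowolski–Mossinghoff).  No irreducibility
assumed. -/
theorem intMahlerMeasure_ge_goldenRatio_of_odd_nonreciprocal {P : ℤ[X]}
    (hodd : ∀ i ≤ P.natDegree, Odd (P.coeff i)) (h1 : P.reverse ≠ P) (h2 : P.reverse ≠ -P) :
    (1 + Real.sqrt 5) / 2 ≤ intMahlerMeasure P := by
  have hs : Real.sqrt 5 ^ 2 = 5 := Real.sq_sqrt (by norm_num)
  have hs0 : 0 ≤ Real.sqrt 5 := Real.sqrt_nonneg 5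
  have hφ2 : (1 + Real.sqrt 5) / 2 ≤ 2 := by nlinarith
  have h0odd : Odd (P.coeff 0) := hodd 0 (Nat.zero_le _)
  have h0 : P.coeff 0 ≠ 0 := fun h => by rw [h] at h0odd; exact (Int.not_odd_iff_even.mpr (by decide)) h0odd
  have hP0 : P ≠ 0 := fun h => h0 (by simp [h])
  -- leading coefficient `± 1`, else `M ≥ 2`
  by_cases hlc : 2 ≤ |P.leadingCoeff|
  · have h := abs_leadingCoeff_le_intMahlerMeasure P
    have : (2 : ℝ) ≤ |(P.leadingCoeff : ℝ)| := by exact_mod_cast hlc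
    linarith
  have hlc1 : |P.leadingCoeff| = 1 := by
    have hne : P.leadingCoeff ≠ 0 := leadingCoeff_ne_zero.mpr hP0
    have := Int.one_le_abs hne
    omega
  -- reduce to the monic case via `P ↦ -P`
  obtain ⟨Q, hQm, hQM, hQodd, hQ1, hQ2⟩ : ∃ Q : ℤ[X], Q.Monic ∧ intMahlerMeasure Q = intMahlerMeasure P ∧
      (∀ i ≤ Q.natDegree, Odd (Q.coeff i)) ∧ Q.reverse ≠ Q ∧ Q.reverse ≠ -Q := by
    rcases (abs_eq (zero_le_one' ℤ)).mp hlc1 with h | h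
    · exact ⟨P, h, rfl, hodd, h1, h2⟩
    · refine ⟨-P, ?_, intMahlerMeasure_neg P, ?_, ?_, ?_⟩
      · rw [Monic, leadingCoeff_neg, h, neg_neg]
      · intro i hi
        rw [natDegree_neg] at hi
        rw [coeff_neg]; exact (hodd i hi).neg
      · rw [reverse_neg]; intro h'; exact h1 (neg_injective h')
      · rw [reverse_neg, neg_neg]; intro h'; exact h2 (by rw [← neg_neg P.reverse, h'])
  rw [← hQM]
  have hQ0odd : Odd (Q.coeff 0) := hQodd 0 (Nat.zero_le _)
  have hQ0 : Q.coeff 0 ≠ 0 := fun h => by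
    rw [h] at hQ0odd; exact (Int.not_odd_iff_even.mpr (by decide)) hQ0odd
  -- constant coefficient `± 1`, else `M ≥ 2`
  by_cases hc : 2 ≤ |Q.coeff 0|
  · have h := abs_coeff_zero_le_intMahlerMeasure hQm
    have : (2 : ℝ) ≤ |(Q.coeff 0 : ℝ)| := by exact_mod_cast hc
    linarith
  have hc1 : |Q.coeff 0| = 1 := by
    have := Int.one_le_abs hQ0
    omega
  set ε := Q.coeff 0 with hεdef
  have hε1 : ε * ε = 1 := by
    rcases (abs_eq (zero_le_one' ℤ)).mp hc1 with h | h <;> simp [h]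
  have hne : Q.reverse ≠ C ε * Q := by
    rcases (abs_eq (zero_le_one' ℤ)).mp hc1 with h | h
    · rw [h, C_1, one_mul]; exact hQ1
    · rw [h, C_neg, C_1, neg_one_mul]; exact hQ2
  obtain ⟨k, a, R, hk, ha, hid⟩ := exists_first_nonpalindromic_coeff hQm rfl hε1 hne
  have ha2 := two_le_abs_first_coeff hQm hQodd hε1 ha hid
  have key := abs_mul_inv_measure_le hQm rfl hε1 hk hid
  have hM1 : 1 ≤ intMahlerMeasure Q := by
    have h := abs_leadingCoeff_le_intMahlerMeasure Q
    rw [hQm.leadingCoeff] at h; simpa using h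
  have hMpos : 0 < intMahlerMeasure Q := lt_of_lt_of_le one_pos hM1
  have ha2' : (2 : ℝ) ≤ |(a : ℝ)| := by exact_mod_cast ha2
  have hx0 : 0 < (intMahlerMeasure Q)⁻¹ := inv_pos.mpr hMpos
  have key' : (intMahlerMeasure Q)⁻¹ + ((intMahlerMeasure Q)⁻¹) ^ 2 ≤ 1 := by
    have : 2 * (intMahlerMeasure Q)⁻¹ ≤ |(a : ℝ)| * (intMahlerMeasure Q)⁻¹ := by gcongr
    nlinarith [key, this]
  exact goldenRatio_le_of_inv hMpos key'

/-- **The Literature named fact `OddCoefficientsNonreciprocalMahlerBound`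
([McKee–Smyth, Prop. 11.3, nonreciprocal part]) holds.** -/
theorem oddCoefficientsNonreciprocalMahlerBound_holds :
    Literature.NumberTheory.MahlerMeasure.OddCoefficientsNonreciprocalMahlerBound :=
  fun _ _ _ hodd h1 h2 => intMahlerMeasure_ge_goldenRatio_of_odd_nonreciprocal hodd h1 h2

end Summit.Ventures.DiscreteObjects.Mahler
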